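import Summits.HodgeConjecture.HodgeConjecture.Theorems.Ring2WeilCoverageCMFieldRationalClassesFibres
import Summits.HodgeConjecture.HodgeConjecture.Theorems.Ring2WeilCoverageCMFieldCyclicPrimeRuleSqrtFive
import Summits.HodgeConjecture.HodgeConjecture.Theorems.Ring2WeilCoverageCMFieldRationalPrimeRuleInstancesI
import Summits.HodgeConjecture.HodgeConjecture.Theorems.Ring2WeilCoverageCMFieldRationalPrimeRuleInstancesII
import Summits.HodgeConjecture.HodgeConjecture.Theorems.Ring2WeilCoverageCMFieldRationalPrimeRuleInstancesIV
import Summits.HodgeConjecture.HodgeConjecture.Theorems.Ring2WeilCoverageCMFieldRationalPrimeRuleInstancesV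
import HarnessLib

/-!
# Ring 2 — Weil-family coverage, CM-field rows: a rational class never contains an INERT place of `F` dividing the
  radicand — the last `|T| = 2` rows of the biquadratic tables (WEIL-FAMILY-COVERAGE «## b03», cell (xxi′)(a), part 38)

research route conditional on HC_CM; not a corollary; Q11.4-sentence-2 already refuted in dim ≥ 3.

Part 33 showed that a RATIONAL class `c ∈ ℚ^×` of the table `W_{2k}.E.T` of a biquadratic quartic CM field `E = F(√b₀)`
(`θ = c₁²·b₀`, `b₀ ∈ ℤ`) has `T(c)` saturated over every odd prime `ℓ ∤ b₀` and disjoint from the odd primes ramified in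
`F`.  The remaining odd non-split places of the census tables are the primes `ℓ ∣ b₀` that are INERT in `F` (and ramified
in `E`): `(3) ⊂ ℚ(√2)` for `ℚ(√-3,√2)`, `(5) ⊂ ℚ(√2)` for `ℚ(√-5,√2)`, `(5) ⊂ ℚ(√3)` for `ℚ(√-5,√3)`, `(3) ⊂ ℚ(√5)` for
`ℚ(√-3,√5)`.  Here: **such a place lies in NO `T(c)`, `c ∈ ℚ^×`** — every non-zero rational integer is `ℓ^a·n'` with
`ℓ ∤ n'`; `n'` is a `v`-unit whose residue lies in `𝔽_ℓ ⊂ 𝔽_{ℓ²}^{×2}`, so `n'` is a square in `F_v` and `(n', b₀)_v = 1`;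
and `(ℓ, b₀)_v = (ℓ·1, ℓ·m)_v = 1 ⟺ -m` is a square mod `v` (O'Meara 63:12 with the uniformiser `ℓ` of the unramified
place `v = (ℓ)`), which every rational integer is [cite: Omeara1963, §63B Example 63:12]
[cite: Deligne1982HodgeCycles, §4 (1)].

* §108 the local symbols `(n', b₀)_v = 1` (`ℓ ∤ n'`), `(ℓ, ℓm)_v = 1`, and `(n, ℓm)_v = 1` for every integer `n ≠ 0`;
* §109 **THEOREM (D)**: `v ∉ T(c)` for every `c ∈ ℚ^×`, and the row form `T(c) ≠ {v, w}` for every `w`;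
* §110 instances: the four places above (`N v = ℓ²` by part 21's `absNorm_eq_sq_of_not_isSquare_disc`) — in particular the
  rows `{(√2), (3)}` of `W8.ℚ(√-3,√2)` and `{(√2), (5)}` of `W8.ℚ(√-5,√2)`, the only `|T| = 2` rows inside `S6` of the
  fourteen §b03.29 tables made of two places fixed by `Gal(F/ℚ)`, have no rational member.

No new definition, no named fact, no sorry; nothing about the Hodge conjecture is asserted.
-/

noncomputable section

set_option linter.dupNamespace false

open Polynomial NumberField IsDedekindDomain

namespace Summit.HodgeConjecture.HodgeConjecture.Ring2.WeilCoverageCM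

open Literature.AlgebraicGeometry.Deligne1982
open Literature.AlgebraicGeometry.HodgeTheory (splitDiscriminantClassCM)
open Literature.NumberTheory.QuadraticForms

variable {R : Polynomial ℤ} [Fact (Irreducible (cmPolyQ R))] [Fact (Irreducible (realPolyQ R))]

/-! ### §108 The local symbols at an unramified place of norm `ℓ²` against rational integers -/

omit [Fact (Irreducible (cmPolyQ R))] in
/-- **An integer prime to `ℓ` is a SQUARE in `F_v` at a place `v ∋ ℓ` of norm `ℓ²`** (`v ∤ 2`): its residue lies in the prime
field `𝔽_ℓ`, whose elements are squares in `𝔽_{ℓ²}` (part 13), and Hensel. Hence `(n', t)_v = 1` for every `t`.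
[cite: Omeara1963, §63B Example 63:12] -/
theorem hilbertSymbol_adicCompletion_intCast_eq_one_of_not_dvd {ℓ : ℕ} (hℓ : ℓ.Prime) (hℓ2 : ℓ ≠ 2)
    (v : HeightOneSpectrum (𝓞 (realField R))) (hv : (ℓ : 𝓞 (realField R)) ∈ v.asIdeal)
    (hN : Ideal.absNorm v.asIdeal = ℓ ^ 2) {n : ℤ} (hn : ¬ (ℓ : ℤ) ∣ n) (t : v.adicCompletion (realField R)) :
    hilbertSymbol (v.adicCompletion (realField R)) (algebraMap (realField R) _ (n : realField R)) t = 1 := by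
  have h2ℓ : ¬ (ℓ : ℤ) ∣ 2 := fun h ↦
    hℓ2 ((Nat.prime_dvd_prime_iff_eq hℓ Nat.prime_two).1 (by exact_mod_cast h))
  have h2 : (2 : 𝓞 (realField R)) ∉ v.asIdeal := by
    have h := (intCast_mem_iff_natCast_dvd hℓ v hv 2).not.2 h2ℓ
    rwa [Int.cast_ofNat] at h
  have hnv : (n : 𝓞 (realField R)) ∉ v.asIdeal := (intCast_mem_iff_natCast_dvd hℓ v hv n).not.2 hn
  have hsq : IsSquare (algebraMap (𝓞 (realField R)) (v.adicCompletion (realField R)) (n : 𝓞 (realField R))) :=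
    (isSquare_algebraMap_adicCompletion_iff (realField R) v h2 hnv).2 (isSquare_intCast_residue_of_absNorm_eq_sq v hℓ hN n)
  have e : algebraMap (realField R) (v.adicCompletion (realField R)) (n : realField R) =
      algebraMap (𝓞 (realField R)) (v.adicCompletion (realField R)) (n : 𝓞 (realField R)) := by
    rw [IsScalarTower.algebraMap_apply (𝓞 (realField R)) (realField R) (v.adicCompletion (realField R)),
      map_intCast (algebraMap (𝓞 (realField R)) (realField R))]
  rw [e]
  exact hilbertSymbol_eq_one_of_isSquare hsq (algebraMap_adicCompletion_ne_zero (realField R) v hnv) t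

omit [Fact (Irreducible (cmPolyQ R))] in
/-- **`(ℓ, ℓ·m)_v = 1`** at a place `v ∋ ℓ` of norm `ℓ²` with `ord_v ℓ = 1` (`v ∤ 2`, `ℓ ∤ m`): by O'Meara 63:12
`(ℓ·1, ℓ·m)_v = 1 ⟺ -m` is a square mod `v`, and `-m ∈ ℤ` is a square in `𝔽_{ℓ²}`. [cite: Omeara1963, §63B Example 63:12] -/
theorem hilbertSymbol_adicCompletion_natCast_intCast_mul_eq_one {ℓ : ℕ} (hℓ : ℓ.Prime) (hℓ2 : ℓ ≠ 2)
    (v : HeightOneSpectrum (𝓞 (realField R))) (hv : (ℓ : 𝓞 (realField R)) ∈ v.asIdeal)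
    (hval : v.intValuation (ℓ : 𝓞 (realField R)) = WithZero.exp (-1 : ℤ)) (hN : Ideal.absNorm v.asIdeal = ℓ ^ 2)
    {b₀ m : ℤ} (hb : b₀ = ℓ * m) (hm : ¬ (ℓ : ℤ) ∣ m) :
    hilbertSymbol (v.adicCompletion (realField R)) (algebraMap (realField R) _ (ℓ : realField R))
      (algebraMap (realField R) _ (b₀ : realField R)) = 1 := by
  have h2ℓ : ¬ (ℓ : ℤ) ∣ 2 := fun h ↦
    hℓ2 ((Nat.prime_dvd_prime_iff_eq hℓ Nat.prime_two).1 (by exact_mod_cast h))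
  have h2 : (2 : 𝓞 (realField R)) ∉ v.asIdeal := by
    have h := (intCast_mem_iff_natCast_dvd hℓ v hv 2).not.2 h2ℓ
    rwa [Int.cast_ofNat] at h
  have hmv : (m : 𝓞 (realField R)) ∉ v.asIdeal := (intCast_mem_iff_natCast_dvd hℓ v hv m).not.2 hm
  have h1 : (1 : 𝓞 (realField R)) ∉ v.asIdeal := fun h ↦ v.isPrime.ne_top ((Ideal.eq_top_iff_one _).2 h)
  have key := hilbertSymbol_uniformizer_mul_uniformizer_mul_iff (realField R) v h2 hval h1 hmv
  have hsq : IsSquare (Ideal.Quotient.mk v.asIdeal (-(1 * (m : 𝓞 (realField R))))) := by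
    have h := isSquare_intCast_residue_of_absNorm_eq_sq v hℓ hN (-m)
    rwa [one_mul, ← Int.cast_neg]
  have e := key.2 hsq
  have e1 : algebraMap (realField R) (v.adicCompletion (realField R)) (ℓ : realField R) =
      algebraMap (𝓞 (realField R)) (v.adicCompletion (realField R)) ((ℓ : 𝓞 (realField R)) * 1) := by
    rw [mul_one, IsScalarTower.algebraMap_apply (𝓞 (realField R)) (realField R) (v.adicCompletion (realField R)),
      map_natCast (algebraMap (𝓞 (realField R)) (realField R))]
  have e2 : algebraMap (realField R) (v.adicCompletion (realField R)) (b₀ : realField R) =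
      algebraMap (𝓞 (realField R)) (v.adicCompletion (realField R)) ((ℓ : 𝓞 (realField R)) * m) := by
    rw [IsScalarTower.algebraMap_apply (𝓞 (realField R)) (realField R) (v.adicCompletion (realField R)), map_mul,
      map_natCast (algebraMap (𝓞 (realField R)) (realField R)), map_intCast (algebraMap (𝓞 (realField R)) (realField R)),
      hb, Int.cast_mul, Int.cast_natCast]
  rw [e1, e2]
  exact e

omit [Fact (Irreducible (cmPolyQ R))] in
/-- **`(n, ℓ·m)_v = 1` for EVERY integer `n ≠ 0`** (`v`, `ℓ`, `m` as above): `n = ℓ^a·n'` with `ℓ ∤ n'`, and the symbol is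
multiplicative in the first variable. [cite: Omeara1963, §63B Example 63:12 and (formulas after 63:10)] -/
theorem hilbertSymbol_adicCompletion_intCast_natCast_mul_eq_one {ℓ : ℕ} (hℓ : ℓ.Prime) (hℓ2 : ℓ ≠ 2)
    (v : HeightOneSpectrum (𝓞 (realField R))) (hv : (ℓ : 𝓞 (realField R)) ∈ v.asIdeal)
    (hval : v.intValuation (ℓ : 𝓞 (realField R)) = WithZero.exp (-1 : ℤ)) (hN : Ideal.absNorm v.asIdeal = ℓ ^ 2)
    {b₀ m : ℤ} (hb : b₀ = ℓ * m) (hm : ¬ (ℓ : ℤ) ∣ m) {n : ℤ} (hn : n ≠ 0) :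
    hilbertSymbol (v.adicCompletion (realField R)) (algebraMap (realField R) _ (n : realField R))
      (algebraMap (realField R) _ (b₀ : realField R)) = 1 := by
  have hfin : FiniteMultiplicity (ℓ : ℤ) n :=
    Int.finiteMultiplicity_iff.2 ⟨by rw [Int.natAbs_natCast]; exact hℓ.one_lt.ne', hn⟩
  obtain ⟨n', hn', hnd⟩ := hfin.exists_eq_pow_mul_and_not_dvd
  have hm0 : m ≠ 0 := by rintro rfl; exact hm (dvd_zero _)
  have hb0' : b₀ ≠ 0 := by rw [hb]; exact mul_ne_zero (by exact_mod_cast hℓ.ne_zero) hm0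
  have hb0 : algebraMap (realField R) (v.adicCompletion (realField R)) (b₀ : realField R) ≠ 0 := by
    rw [_root_.map_ne_zero, Int.cast_ne_zero]; exact hb0'
  have hℓ0 : algebraMap (realField R) (v.adicCompletion (realField R)) (ℓ : realField R) ≠ 0 := by
    rw [_root_.map_ne_zero]; exact_mod_cast hℓ.ne_zero
  have hn'0 : n' ≠ 0 := by rintro rfl; exact hnd (dvd_zero _)
  have step : ∀ a : ℕ, hilbertSymbol (v.adicCompletion (realField R))
      (algebraMap (realField R) _ (((ℓ : ℤ) ^ a * n' : ℤ) : realField R))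
      (algebraMap (realField R) _ (b₀ : realField R)) = 1 := by
    intro a
    induction a with
    | zero =>
      rw [pow_zero, one_mul]
      exact hilbertSymbol_adicCompletion_intCast_eq_one_of_not_dvd hℓ hℓ2 v hv hN hnd _
    | succ a ih =>
      have hx : algebraMap (realField R) (v.adicCompletion (realField R)) (((ℓ : ℤ) ^ a * n' : ℤ) : realField R) ≠ 0 := by
        rw [_root_.map_ne_zero, Int.cast_ne_zero]
        exact mul_ne_zero (pow_ne_zero _ (by exact_mod_cast hℓ.ne_zero)) hn'0
      have e : (((ℓ : ℤ) ^ (a + 1) * n' : ℤ) : realField R) =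
          (ℓ : realField R) * (((ℓ : ℤ) ^ a * n' : ℤ) : realField R) := by
        push_cast
        ring
      rw [e, map_mul, hilbertSymbol_adicCompletion_mul_left (realField R) v hℓ0 hx hb0, ih, mul_one]
      exact hilbertSymbol_adicCompletion_natCast_intCast_mul_eq_one hℓ hℓ2 v hv hval hN hb hm
  have h := step (multiplicity (ℓ : ℤ) n)
  rwa [← hn'] at h

/-! ### §109 THEOREM (D): an inert place dividing the radicand lies in no rational class -/

/-- **(D) AN ODD PRIME INERT IN `F` DIVIDING THE RADICAND**: let `E = F(√b₀)` (`θ = c₁²·b₀`, `b₀ = ℓ·m ∈ ℤ`, `ℓ` odd,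
`ℓ ∤ m`) and `v ∋ ℓ` a place of `F` of norm `ℓ²` (`ℓ` inert in the quadratic field `F`, so `v = (ℓ)`, `ord_v ℓ = 1`; `v` is
ramified in `E`). Then `v` lies in NO `T(c)`, `c ∈ ℚ^×`: `(c, θ)_v = (c, b₀)_v = (num, b₀)_v (den, b₀)_v = 1`.
[cite: Omeara1963, §63B Example 63:12] [cite: Deligne1982HodgeCycles, §4 (1)] -/
theorem inl_notMem_badPlaces_ratCast_of_dvd_radicand {p₀ q₀ : ℤ} (hR : R = X ^ 2 + C p₀ * X + C q₀)
    {c₁ : realField R} {b₀ : ℤ}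
    (hfac : AdjoinRoot.root (realPolyQ R) = c₁ ^ 2 * ((b₀ : 𝓞 (realField R)) : realField R))
    {ℓ : ℕ} (hℓ : ℓ.Prime) (hℓ2 : ℓ ≠ 2) {m : ℤ} (hb : b₀ = ℓ * m) (hm : ¬ (ℓ : ℤ) ∣ m)
    (v : HeightOneSpectrum (𝓞 (realField R))) (hv : (ℓ : 𝓞 (realField R)) ∈ v.asIdeal)
    (hN : Ideal.absNorm v.asIdeal = ℓ ^ 2) {c : ℚ} (hc : c ≠ 0) :
    Sum.inl v ∉ badPlaces (c : realField R) (AdjoinRoot.root (realPolyQ R)) := by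
  obtain ⟨-, hval, -⟩ := asIdeal_eq_span_of_absNorm_eq_sq (finrank_realField_quadratic hR) hℓ v hv hN
  rw [badPlaces_root_eq_of_eq_sq_mul hfac, mem_badPlaces_iff, placeSymbol_inl,
    show ((b₀ : 𝓞 (realField R)) : realField R) = (b₀ : realField R) from
      map_intCast (algebraMap (𝓞 (realField R)) (realField R)) _]
  have hm0 : m ≠ 0 := by rintro rfl; exact hm (dvd_zero _)
  have hb0 : algebraMap (realField R) (v.adicCompletion (realField R)) (b₀ : realField R) ≠ 0 := by
    rw [_root_.map_ne_zero, Int.cast_ne_zero, hb]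
    exact mul_ne_zero (by exact_mod_cast hℓ.ne_zero) hm0
  have hnum : c.num ≠ 0 := Rat.num_ne_zero.2 hc
  have hden : (c.den : ℤ) ≠ 0 := by exact_mod_cast c.den_nz
  have hnum' : algebraMap (realField R) (v.adicCompletion (realField R)) (c.num : realField R) ≠ 0 := by
    rw [_root_.map_ne_zero, Int.cast_ne_zero]; exact hnum
  have hden' : algebraMap (realField R) (v.adicCompletion (realField R)) ((c.den : ℤ) : realField R) ≠ 0 := by
    rw [_root_.map_ne_zero, Int.cast_ne_zero]; exact hden
  have ec : (c : realField R) = (c.num : realField R) * (((c.den : ℤ) : realField R))⁻¹ := by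
    rw [Int.cast_natCast, ← div_eq_mul_inv, Rat.cast_def]
  have key : hilbertSymbol (v.adicCompletion (realField R))
      (algebraMap (realField R) _ (c : realField R)) (algebraMap (realField R) _ (b₀ : realField R)) = 1 := by
    rw [ec, map_mul, map_inv₀,
      hilbertSymbol_adicCompletion_mul_left (realField R) v hnum' (inv_ne_zero hden') hb0,
      hilbertSymbol_inv_left hden',
      hilbertSymbol_adicCompletion_intCast_natCast_mul_eq_one hℓ hℓ2 v hv hval hN hb hm hnum,
      hilbertSymbol_adicCompletion_intCast_natCast_mul_eq_one hℓ hℓ2 v hv hval hN hb hm hden, mul_one]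
  rw [key]
  decide

/-- **(D), row form**: with `v` as in (D), `T(c) ≠ {v, w}` for every place `w` and every `c ∈ ℚ^×`.
[cite: Deligne1982HodgeCycles, §4 (1) and Cor. 4.2] -/
theorem badPlaces_ratCast_ne_pair_of_dvd_radicand {p₀ q₀ : ℤ} (hR : R = X ^ 2 + C p₀ * X + C q₀)
    {c₁ : realField R} {b₀ : ℤ}
    (hfac : AdjoinRoot.root (realPolyQ R) = c₁ ^ 2 * ((b₀ : 𝓞 (realField R)) : realField R))
    {ℓ : ℕ} (hℓ : ℓ.Prime) (hℓ2 : ℓ ≠ 2) {m : ℤ} (hb : b₀ = ℓ * m) (hm : ¬ (ℓ : ℤ) ∣ m)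
    (v : HeightOneSpectrum (𝓞 (realField R))) (hv : (ℓ : 𝓞 (realField R)) ∈ v.asIdeal)
    (hN : Ideal.absNorm v.asIdeal = ℓ ^ 2) (w : HeightOneSpectrum (𝓞 (realField R))) {c : ℚ} (hc : c ≠ 0) :
    badPlaces (c : realField R) (AdjoinRoot.root (realPolyQ R)) ≠ {Sum.inl v, Sum.inl w} := by
  intro h
  have h1 : Sum.inl v ∈ badPlaces (c : realField R) (AdjoinRoot.root (realPolyQ R)) := by
    rw [h]; exact Set.mem_insert _ _
  exact inl_notMem_badPlaces_ratCast_of_dvd_radicand hR hfac hℓ hℓ2 hb hm v hv hN hc h1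

/-! ### §110 Instances: `(3) ⊂ ℚ(√2)`, `(5) ⊂ ℚ(√2)`, `(5) ⊂ ℚ(√3)`, `(3) ⊂ ℚ(√5)` -/

/-- **`ℚ(√-3,√2)`: the place `(3)` of `F = ℚ(√2)`** (`3` inert in `F`, `N v = 9`; dividing the radicand `b₀ = -3`, ramified in
`E`) **lies in NO `T(c)`, `c ∈ ℚ^×`.** [cite: Omeara1963, §63B Example 63:12] [cite: Deligne1982HodgeCycles, §4 (1)] -/
theorem sqrtNeg3Sqrt2_inl_notMem_badPlaces_ratCast_of_mem_three (hR : R = X ^ 2 + C 18 * X + C 9)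
    (v : HeightOneSpectrum (𝓞 (realField R))) (hv : (3 : 𝓞 (realField R)) ∈ v.asIdeal) {c : ℚ} (hc : c ≠ 0) :
    Sum.inl v ∉ badPlaces (c : realField R) (AdjoinRoot.root (realPolyQ R)) := by
  have hrel := root_rel_quadratic hR
  push_cast at hrel
  have hfac : AdjoinRoot.root (realPolyQ R) = ((-1/2 : realField R) + (-1/6 : realField R) * AdjoinRoot.root (realPolyQ R)) ^ 2
      * (((-(3 : ℕ) : ℤ) : 𝓞 (realField R)) : realField R) := by
    rw [show (((-(3 : ℕ) : ℤ) : 𝓞 (realField R)) : realField R) = ((-(3 : ℕ) : ℤ) : realField R) from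
      map_intCast (algebraMap (𝓞 (realField R)) (realField R)) _]
    push_cast
    linear_combination (1/12 : realField R) * hrel
  obtain ⟨s, -, hs⟩ := sqrtNeg3Sqrt2_ratPrimeRule_exists_sq_eq_2 hR
  have hs' : s ^ 2 = ((2 : ℤ) : 𝓞 (realField R)) := by rw [hs]; norm_num
  have hv' : ((3 : ℕ) : 𝓞 (realField R)) ∈ v.asIdeal := by exact_mod_cast hv
  have hnd : ¬ IsSquare (((2 : ℤ) : ℤ) : ZMod 3) := by decide
  have hN := absNorm_eq_sq_of_inert_radicand (finrank_realField_quadratic hR) hs' Nat.prime_three hnd v hv'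
  exact inl_notMem_badPlaces_ratCast_of_dvd_radicand hR hfac Nat.prime_three (by norm_num)
    (m := -1) (by norm_num) (by norm_num) v hv' hN hc

/-- **`ℚ(√-3,√2)`, row form at the inert prime `3`**: `T(c) ≠ {v, w}` for the place `v ∋ 3`, every place `w` and every
`c ∈ ℚ^×`. [cite: Deligne1982HodgeCycles, §4 (1) and Cor. 4.2] -/
theorem sqrtNeg3Sqrt2_badPlaces_ratCast_ne_pair_of_mem_three (hR : R = X ^ 2 + C 18 * X + C 9)
    (v w : HeightOneSpectrum (𝓞 (realField R))) (hv : (3 : 𝓞 (realField R)) ∈ v.asIdeal) {c : ℚ} (hc : c ≠ 0) :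
    badPlaces (c : realField R) (AdjoinRoot.root (realPolyQ R)) ≠ {Sum.inl v, Sum.inl w} := by
  intro h
  have h1 : Sum.inl v ∈ badPlaces (c : realField R) (AdjoinRoot.root (realPolyQ R)) := by
    rw [h]; exact Set.mem_insert _ _
  exact sqrtNeg3Sqrt2_inl_notMem_badPlaces_ratCast_of_mem_three hR v hv hc h1

/-- **`ℚ(√-5,√2)`: the place `(5)` of `F = ℚ(√2)`** (`5` inert in `F`, `N v = 25`; dividing the radicand `b₀ = -5`, ramified in
`E`) **lies in NO `T(c)`, `c ∈ ℚ^×`.** [cite: Omeara1963, §63B Example 63:12] [cite: Deligne1982HodgeCycles, §4 (1)] -/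
theorem sqrtNeg5Sqrt2_inl_notMem_badPlaces_ratCast_of_mem_five (hR : R = X ^ 2 + C 30 * X + C 25)
    (v : HeightOneSpectrum (𝓞 (realField R))) (hv : (5 : 𝓞 (realField R)) ∈ v.asIdeal) {c : ℚ} (hc : c ≠ 0) :
    Sum.inl v ∉ badPlaces (c : realField R) (AdjoinRoot.root (realPolyQ R)) := by
  have hrel := root_rel_quadratic hR
  push_cast at hrel
  have hfac : AdjoinRoot.root (realPolyQ R) = ((-1/2 : realField R) + (-1/10 : realField R) * AdjoinRoot.root (realPolyQ R)) ^ 2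
      * (((-(5 : ℕ) : ℤ) : 𝓞 (realField R)) : realField R) := by
    rw [show (((-(5 : ℕ) : ℤ) : 𝓞 (realField R)) : realField R) = ((-(5 : ℕ) : ℤ) : realField R) from
      map_intCast (algebraMap (𝓞 (realField R)) (realField R)) _]
    push_cast
    linear_combination (1/20 : realField R) * hrel
  obtain ⟨s, -, hs⟩ := sqrtNeg5Sqrt2_ratPrimeRule_exists_sq_eq_2 hR
  have hs' : s ^ 2 = ((2 : ℤ) : 𝓞 (realField R)) := by rw [hs]; norm_num
  have hv' : ((5 : ℕ) : 𝓞 (realField R)) ∈ v.asIdeal := by exact_mod_cast hv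
  have hnd : ¬ IsSquare (((2 : ℤ) : ℤ) : ZMod 5) := by decide
  have hN := absNorm_eq_sq_of_inert_radicand (finrank_realField_quadratic hR) hs' Nat.prime_five hnd v hv'
  exact inl_notMem_badPlaces_ratCast_of_dvd_radicand hR hfac Nat.prime_five (by norm_num)
    (m := -1) (by norm_num) (by norm_num) v hv' hN hc

/-- **`ℚ(√-5,√2)`, row form at the inert prime `5`**: `T(c) ≠ {v, w}` for the place `v ∋ 5`, every place `w` and every
`c ∈ ℚ^×`. [cite: Deligne1982HodgeCycles, §4 (1) and Cor. 4.2] -/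
theorem sqrtNeg5Sqrt2_badPlaces_ratCast_ne_pair_of_mem_five (hR : R = X ^ 2 + C 30 * X + C 25)
    (v w : HeightOneSpectrum (𝓞 (realField R))) (hv : (5 : 𝓞 (realField R)) ∈ v.asIdeal) {c : ℚ} (hc : c ≠ 0) :
    badPlaces (c : realField R) (AdjoinRoot.root (realPolyQ R)) ≠ {Sum.inl v, Sum.inl w} := by
  intro h
  have h1 : Sum.inl v ∈ badPlaces (c : realField R) (AdjoinRoot.root (realPolyQ R)) := by
    rw [h]; exact Set.mem_insert _ _
  exact sqrtNeg5Sqrt2_inl_notMem_badPlaces_ratCast_of_mem_five hR v hv hc h1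

/-- **`ℚ(√-5,√3)`: the place `(5)` of `F = ℚ(√3)`** (`5` inert in `F`, `N v = 25`; dividing the radicand `b₀ = -5`, ramified in
`E`) **lies in NO `T(c)`, `c ∈ ℚ^×`.** [cite: Omeara1963, §63B Example 63:12] [cite: Deligne1982HodgeCycles, §4 (1)] -/
theorem sqrtNeg5Sqrt3_inl_notMem_badPlaces_ratCast_of_mem_five (hR : R = X ^ 2 + C 40 * X + C 100)
    (v : HeightOneSpectrum (𝓞 (realField R))) (hv : (5 : 𝓞 (realField R)) ∈ v.asIdeal) {c : ℚ} (hc : c ≠ 0) :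
    Sum.inl v ∉ badPlaces (c : realField R) (AdjoinRoot.root (realPolyQ R)) := by
  have hrel := root_rel_quadratic hR
  push_cast at hrel
  have hfac : AdjoinRoot.root (realPolyQ R) = ((-1 : realField R) + (-1/10 : realField R) * AdjoinRoot.root (realPolyQ R)) ^ 2
      * (((-(5 : ℕ) : ℤ) : 𝓞 (realField R)) : realField R) := by
    rw [show (((-(5 : ℕ) : ℤ) : 𝓞 (realField R)) : realField R) = ((-(5 : ℕ) : ℤ) : realField R) from
      map_intCast (algebraMap (𝓞 (realField R)) (realField R)) _]
    push_cast
    linear_combination (1/20 : realField R) * hrel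
  obtain ⟨s, -, hs⟩ := sqrtNeg5Sqrt3_ratPrimeRule_exists_sq_eq_3 hR
  have hs' : s ^ 2 = ((3 : ℤ) : 𝓞 (realField R)) := by rw [hs]; norm_num
  have hv' : ((5 : ℕ) : 𝓞 (realField R)) ∈ v.asIdeal := by exact_mod_cast hv
  have hnd : ¬ IsSquare (((3 : ℤ) : ℤ) : ZMod 5) := by decide
  have hN := absNorm_eq_sq_of_inert_radicand (finrank_realField_quadratic hR) hs' Nat.prime_five hnd v hv'
  exact inl_notMem_badPlaces_ratCast_of_dvd_radicand hR hfac Nat.prime_five (by norm_num)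
    (m := -1) (by norm_num) (by norm_num) v hv' hN hc

/-- **`ℚ(√-5,√3)`, row form at the inert prime `5`**: `T(c) ≠ {v, w}` for the place `v ∋ 5`, every place `w` and every
`c ∈ ℚ^×`. [cite: Deligne1982HodgeCycles, §4 (1) and Cor. 4.2] -/
theorem sqrtNeg5Sqrt3_badPlaces_ratCast_ne_pair_of_mem_five (hR : R = X ^ 2 + C 40 * X + C 100)
    (v w : HeightOneSpectrum (𝓞 (realField R))) (hv : (5 : 𝓞 (realField R)) ∈ v.asIdeal) {c : ℚ} (hc : c ≠ 0) :
    badPlaces (c : realField R) (AdjoinRoot.root (realPolyQ R)) ≠ {Sum.inl v, Sum.inl w} := by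
  intro h
  have h1 : Sum.inl v ∈ badPlaces (c : realField R) (AdjoinRoot.root (realPolyQ R)) := by
    rw [h]; exact Set.mem_insert _ _
  exact sqrtNeg5Sqrt3_inl_notMem_badPlaces_ratCast_of_mem_five hR v hv hc h1

/-- **`ℚ(√-3,√5)`: the place `(3)` of `F = ℚ(√5)`** (`3` inert in `F`, `N v = 9`; dividing the radicand `b₀ = -3`, ramified in
`E`) **lies in NO `T(c)`, `c ∈ ℚ^×`.** [cite: Omeara1963, §63B Example 63:12] [cite: Deligne1982HodgeCycles, §4 (1)] -/
theorem sqrtNeg3Sqrt5_inl_notMem_badPlaces_ratCast_of_mem_three (hR : R = X ^ 2 + C 9 * X + C 9)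
    (v : HeightOneSpectrum (𝓞 (realField R))) (hv : (3 : 𝓞 (realField R)) ∈ v.asIdeal) {c : ℚ} (hc : c ≠ 0) :
    Sum.inl v ∉ badPlaces (c : realField R) (AdjoinRoot.root (realPolyQ R)) := by
  have hrel := root_rel_quadratic hR
  push_cast at hrel
  have hfac : AdjoinRoot.root (realPolyQ R) = ((1 : realField R) + (1/3 : realField R) * AdjoinRoot.root (realPolyQ R)) ^ 2
      * (((-(3 : ℕ) : ℤ) : 𝓞 (realField R)) : realField R) := by
    rw [show (((-(3 : ℕ) : ℤ) : 𝓞 (realField R)) : realField R) = ((-(3 : ℕ) : ℤ) : realField R) from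
      map_intCast (algebraMap (𝓞 (realField R)) (realField R)) _]
    push_cast
    linear_combination (1/3 : realField R) * hrel
  obtain ⟨s, -, hs⟩ := sqrtNeg3Sqrt5_ratPrimeRule_exists_sq_eq_5 hR
  have hs' : s ^ 2 = ((5 : ℤ) : 𝓞 (realField R)) := by rw [hs]; norm_num
  have hv' : ((3 : ℕ) : 𝓞 (realField R)) ∈ v.asIdeal := by exact_mod_cast hv
  have hnd : ¬ IsSquare (((5 : ℤ) : ℤ) : ZMod 3) := by decide
  have hN := absNorm_eq_sq_of_inert_radicand (finrank_realField_quadratic hR) hs' Nat.prime_three hnd v hv'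
  exact inl_notMem_badPlaces_ratCast_of_dvd_radicand hR hfac Nat.prime_three (by norm_num)
    (m := -1) (by norm_num) (by norm_num) v hv' hN hc

/-- **`ℚ(√-3,√5)`, row form at the inert prime `3`**: `T(c) ≠ {v, w}` for the place `v ∋ 3`, every place `w` and every
`c ∈ ℚ^×`. [cite: Deligne1982HodgeCycles, §4 (1) and Cor. 4.2] -/
theorem sqrtNeg3Sqrt5_badPlaces_ratCast_ne_pair_of_mem_three (hR : R = X ^ 2 + C 9 * X + C 9)
    (v w : HeightOneSpectrum (𝓞 (realField R))) (hv : (3 : 𝓞 (realField R)) ∈ v.asIdeal) {c : ℚ} (hc : c ≠ 0) :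
    badPlaces (c : realField R) (AdjoinRoot.root (realPolyQ R)) ≠ {Sum.inl v, Sum.inl w} := by
  intro h
  have h1 : Sum.inl v ∈ badPlaces (c : realField R) (AdjoinRoot.root (realPolyQ R)) := by
    rw [h]; exact Set.mem_insert _ _
  exact sqrtNeg3Sqrt5_inl_notMem_badPlaces_ratCast_of_mem_three hR v hv hc h1


end Summit.HodgeConjecture.HodgeConjecture.Ring2.WeilCoverageCM

end
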